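import Summits.BirchSwinnertonDyer.BirchSwinnertonDyer.Theses.PrintX11a
import Summits.BirchSwinnertonDyer.BirchSwinnertonDyer.Theorems.PrintX11aUpperNonSurjFiveNoPTorsionSector
import Summits.BirchSwinnertonDyer.BirchSwinnertonDyer.Theorems.PrintX11aUpperNonSurjFiveCoreResiduals
import Literature.NumberTheory.EllipticCurves.QuadraticTwist
import Literature.NumberTheory.EllipticCurves.Tamagawa
import HarnessLib

/-!
# Line `sqparity5` (REV 3) — U5 (`Theses.PrintX11a.UpperNonSurjFive`, item stmt-BirchSwinnertonDyer-20614) by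
# «square-class parity transport» on the record's EXPONENT CORE R′♭, with the depth-split Kolyvagin engine typed as a free-standing target
# (bsd-idea-6 g10, lens decomp; W-79 publish-only)

TARGET (verbatim): `∀ W p, ClassX11a W p → ¬ Surj W p → 5 ≤ p → MissingUpperBoundAt W p`.

STATE OF THE CRUX (record «gl1cartan5» REV 9, landed `Theorems/PrintX11aUpperNonSurjFiveCoreResiduals.lean`, lead g4 22:22Z): U5 ⟺ UNIT ∧ SECTOR′ ∧
R′♭ ∧ R₁′♭; UNIT (the sector `p ∤ #Ш_an`, hence `Ш[p] = 0`) and SECTOR′ are closed modulo NINE print-exact named facts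
(`upperNonSurjFive_of_nineFacts_of_coreResiduals`); the open content is the EXPONENT CORE
R′♭ = «no split multiplicative prime, `Ш(E)[p] ≠ 0`, `ord_p (L(E,1)/Ω) ≠ 0` ⇒ `ord_p #Ш ≤ ord_p #Ш_an`» and the TAMAGAWA CORE R₁′♭.
REV 2 re-glued to R′♭ (on R′♭ the analytic valuation `a := ord_p #Ш_an = ord_p (L(E,1)/Ω)`, landed `padicValRat_shaAn_eq_padicValRat_LOne_div`, is
`≥ 1` for free).  REV 3 (bsd-idea-6 g11, paying critic V#130): (P1) `EvenShaAn` — «`ord_p #Ш_an(E)` even on R′♭'s locus» — is registered as THE open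
stub of the low stratum and T ∧ A become hypothesis-taking WITNESS FREEDOM (§3b; A ⟺ `EvenShaAn` modulo T); strength line: U5|{`e = 2`} ⟸ `EvenShaAn` ⟸
BSD_p, stronger than the target on the stratum, BSD-implied, per-curve decidable, class-wide = parity of the valuation of Waldspurger's constant, no
printed handle, cannot fire in a BSD-consistent world; (P2) T's square-class condition is imposed at ALL primes of the level `M` of the weight-3/2
packet member (`SquareClassTwist W p M d W'`, `∃ M` in T, `∀ M` in A), and «multiplicity one» is replaced by `ℚ`-rationality of the `f`-isotypic
subspace + a rational member with `c_g(1) ≠ 0`.  Record meanwhile moved to REV 10 (three cores C_exc/C_exp/C_tam; rev 9 ⟺ rev 10 modulo the nine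
facts, landed p677281/p677750), so the rev-9 glue used below is current.

THIS LINE decomposes R′♭ by `e := ord_p #Ш(E)` (even by Cassels–Tate: R′♭ = {`e = 2`} ⊔ {`e ≥ 4`}) and closes {`e = 2`} — the minimal non-trivial `Ш`,
containing all 15 known members — by ONE lever no registered line uses:

* E (`EvenShaAn`, THE OPEN STUB) with T + A as witness freedom (`ParityTransport`, PRINT modulo transcription; `ParityAnchor`, twist EXISTENCE,
  per-pair decidable): **Waldspurger square-class parity**.  For `d > 0` a square unit at every `ℓ ∣ 2pN·M` (`M` = level of a `ℚ`-rational packet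
  member `g` with `c_g(1) ≠ 0`), Waldspurger 1981 Cor. 2 makes `L(E^d,1)√d / L(E,1)` a rational square times explicit factors; `E^d ≅ E` over `ℚ_ℓ` at
  bad `ℓ` (equal Tamagawa numbers), `c_ℓ(E^d) ∈ {1,2,4}` at `ℓ ∣ d`, `p ∤ #tors`, twisting period factor a power of `2` (Pal 2012): so
  `ord_p #Ш_an(E^d) ≡ ord_p #Ш_an(E) (mod 2)` across the class, and ONE admissible twist with EVEN (e.g. zero = `p`-unit) valuation gives `EvenShaAn`,
  hence `a ≥ 2 ≥ e` on {`e = 2`} — the `p`-adic shadow of «`#Ш_an` is a square», which no Euler system and no congruence sees.  The typed residual H♭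
  (`HigherStratumCore`) is U5 on R′♭ ∩ {`e ≥ 3`} (census-empty).
* K (`ExponentBound`, §4, TYPED AND PROBED BUT NOT A STUB — nothing in the composition consumes it after rev 9): **one Kolyvagin prime of depth `j`**
  for KATO's Euler system at Cartan-normaliser / `2.S₄` image.  No Kolyvagin prime has a rank-one local condition there (no transvection — barrier
  `EulerSystemBigImageAtSmallImage`), but primes with `ρ_{E,p^{2j}}(Frob_q) = 1 + p^jX`, `tr X ≡ 0 (p^j)`, `X̄ ∈ GL₂(𝔽_p)` have
  `H¹_f(ℚ_q,E[p^{2j}]) ≅ H¹_s ≅ (ℤ/p^j)²` FREE OF RANK TWO with invertible finite–singular map `Q_q(Frob_q⁻¹) ≡ −p^jX̄`; one such prime bounds the SECOND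
  elementary divisor of the strict Selmer group by Kato's index `M₀`, and with `#Ш[p^∞]/S_{Σ_p} ∣ p^{a−M₀}` (duality at `p`) and Cassels–Tate:
  `p^{a}·Ш(E)[p^∞] = 0` — the EXPONENT of `Ш[p^∞]` is bounded by the analytic order, image-free (the global-torsion error vanishes because
  `−I ∈ im ρ_{E,p^∞}`).  Offered as the Euler-system currency for `a ≥ k₁` on every stratum and as the first rung of the rank-two induction H♭ needs;
  §4 also records the EULER-SYSTEM-CURRENCY composition `UpperNonSurjFive_of_hyps_ES`: three print facts (GZK, modularity, Mazur) + rev 8's R₁′ + K + T + A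
  + H ⊢ U5 BY NAME through the rev-8 glue — K replaces the μ-road's six extra facts; hypothesis-taking, no stubs, credits nothing.
* Composition (kernel-checked): nine facts (BY NAME, one stub) + `EvenShaAn` + H♭ ⊢ R′♭; + R₁′♭ (record's rev-9 core, verbatim) ⊢ U5 via the landed rev-9 glue.

Stubs (4): `stub_nineFacts`, `stub_splitMultCore` (R₁′♭ verbatim), `stub_evenShaAn` (E, THE open stub), `stub_higherStratumCore` (H♭).  Real proofs:
`two_le_of_parity`, `exponentCore_of_evenShaAn`, `UpperNonSurjFive_of_hyps`, `UpperNonSurjFive_of_sqparity` (the crux BY NAME); §3b `squareClassTwist_one`,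
`parityAnchor_of_evenShaAn`, `evenShaAn_of_transport_anchor`, `parityAnchor_iff_evenShaAn`, `UpperNonSurjFive_of_hyps_TA` (witness freedom); §4
`firstOrder_of_exponentBound`, `pTorsionResidual_of_exponentBound`, `UpperNonSurjFive_of_hyps_ES`.  BSD is not proved by any of this.
-/

set_option autoImplicit false

noncomputable section

open scoped Classical NumberField

open WeierstrassCurve
  Literature.NumberTheory.EllipticCurves
  Literature.NumberTheory.EllipticCurves.Rank1Residual
  Literature.NumberTheory.EllipticCurves.Rank1Residual.Typed
  Literature.NumberTheory.SerreUniformity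
  Summit.BirchSwinnertonDyer.Rank1Residual
  Summit.BirchSwinnertonDyer.BirchSwinnertonDyer.Theses

namespace Summit.BirchSwinnertonDyer.BirchSwinnertonDyer.Cruxes.UpperNonSurjFive.SqParity

/-! ## §1 Vocabulary -/

/-- **Square-class twist (REV 3: with an auxiliary modulus `M`).**  `W'` is a model of the quadratic twist of `W` by an integer `d > 0` that is
a square UNIT in `ℤ_ℓ` at `ℓ = 2`, at `ℓ = p`, at every prime of bad reduction of `W` AND at every prime `ℓ ∣ M` (`x² ≡ d (mod ℓ³)` solvable with
`ℓ ∤ d`: for `ℓ = 2` this is `d ≡ 1 (mod 8)`).  `M` is the level of the weight-3/2 packet member used for the transport (Waldspurger's class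
condition is imposed at ALL primes of that level, which may exceed `4N` — critic V#130 P2).  Then `E^d ≅ E` over `ℚ_ℓ` at those `ℓ` and over `ℝ`:
Waldspurger's class of `t = 1`. [cite: Waldspurger1981Fourier, Cor. 2] -/
def SquareClassTwist (W : WeierstrassCurve ℚ) (p : ℕ) [Fact p.Prime] (M : ℕ) (d : ℤ) (W' : WeierstrassCurve ℚ) : Prop :=
  0 < d ∧
    (∀ (ℓ : ℕ) [Fact ℓ.Prime], (ℓ = 2 ∨ ℓ = p ∨ ¬ W.HasGoodReductionAtPrime ℓ ∨ ℓ ∣ M) →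
      ¬ ((ℓ : ℤ) ∣ d) ∧ ∃ x : ℤ, ((ℓ : ℤ) ^ 3 ∣ x ^ 2 - d)) ∧
    ∃ C : WeierstrassCurve.VariableChange ℚ, C • W' = W.quadraticTwist (d : ℚ)

/-- **T — square-class parity transport (PRINT modulo transcription; REV 3 typing).**  For every X11a pair there is a modulus `M > 0` (the
level of a `ℚ`-RATIONAL member `g` of the `f_E`-isotypic subspace of `S_{3/2}` with first coefficient `c_g(1) ≠ 0` — the isotypic subspace is
defined over `ℚ` because `f_E` is, and a member with `c_g(1) ≠ 0` exists because `L(E,1) ≠ 0`; NO multiplicity-one statement is used, it is false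
at non-squarefree level) such that for every square-class twist `W'` of analytic rank `0` admissible at `2`, `p`, the bad primes and the primes of
`M`: `ord_p #Ш_an(W') ≡ ord_p #Ш_an(W) (mod 2)` — Waldspurger's Cor. 2 (the central values `L(E^d,1)√d` in one square class at the primes of the
level are ONE constant times `c_g(d)²`, a rational square ratio for rational `g`), local isomorphism at bad primes (equal Tamagawa numbers),
`c_ℓ(E^d) ≤ 4` at `ℓ ∣ d`, `p ∤ #E(ℚ)_tors · #E^d(ℚ)_tors` (irreducible `E[p]`), twisting period factor a power of `2` (Pal 2012).  Why it might
fail: transcription only — the sign/power-of-2 bookkeeping of the period under twisting at `d ≡ 1 (mod 8)`. [cite: Waldspurger1981Fourier, Thm. 1, Cor. 2]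
[cite: Pal2012, Thm. 1.1] [cite: Ono2001, Thm. 3.4] -/
def ParityTransport : Prop :=
  ∀ (W : WeierstrassCurve ℚ) [W.IsElliptic] [W.IsGloballyMinimal] (p : ℕ) [Fact p.Prime],
    ClassX11a W p → 5 ≤ p → ∃ M : ℕ, 0 < M ∧
      ∀ (d : ℤ) (W' : WeierstrassCurve ℚ) [W'.IsElliptic] [W'.IsGloballyMinimal] (q q' : ℚ),
        SquareClassTwist W p M d W' → W'.analyticRank = 0 →
        shaAn W = (q : ℂ) → shaAn W' = (q' : ℂ) → Even (padicValRat p q - padicValRat p q')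

/-- **A — parity anchor (twist EXISTENCE in WITNESS-FREEDOM form; REV 3: for every auxiliary modulus `M`; NOT a stub — see `EvenShaAn`).**
On the exponent core's locus some square-class twist (admissible also at the primes of `M`) of analytic rank `0` has `#Ш_an` of EVEN `p`-adic
valuation — e.g. a `p`-UNIT value `L(E^d,1)/Ω_{E^d}`; `d = 1` is always admissible, so A ⟸ `EvenShaAn` for every `M` and A ⟹ `EvenShaAn` modulo T
(§3b).  Why it might fail: as `EvenShaAn`. [cite: Ono2001, Thm. 1, Cor. 3] [cite: Waldspurger1981Fourier, Cor. 2] -/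
def ParityAnchor : Prop :=
  ∀ (W : WeierstrassCurve ℚ) [W.IsElliptic] [W.IsGloballyMinimal] (p : ℕ) [Fact p.Prime] (M : ℕ),
    ClassX11a W p → ¬ Surj W p → 5 ≤ p → (∀ (ℓ : ℕ) [Fact ℓ.Prime], ¬ W.HasSplitMultiplicativeReductionAtPrime ℓ) →
    (∃ x : W.sha, (p : ℤ) • x = 0 ∧ x ≠ 0) →
    ∃ (d : ℤ) (W' : WeierstrassCurve ℚ) (_ : W'.IsElliptic) (_ : W'.IsGloballyMinimal) (q' : ℚ),
      SquareClassTwist W p M d W' ∧ W'.analyticRank = 0 ∧ shaAn W' = (q' : ℂ) ∧ Even (padicValRat p q')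

/-- **`EvenShaAn` — THE OPEN STUB of the low stratum (REV 3, critic V#130 P1): `p`-adic squareness of the analytic order of `Ш` on R′♭'s locus.**
«`ord_p #Ш_an(E)` is even» = «`ord_p (L(E,1)/Ω_E)` is even» there (`p ∤ #E(ℚ)`, `p ∤ ∏ c` off split primes).  STRENGTH LINE: U5|{`e = 2`} ⟸ `EvenShaAn`
⟸ BSD_p (lower half ∧ U5 ∧ Cassels–Tate); on the stratum it is STRONGER than the target (U5 allows `a = 3, e = 2`), BSD-implied, per-curve decidable
(one modular-symbol value), class-wide = the parity of the valuation of Waldspurger's proportionality constant `κ = L(E,1)/c_g(1)²·(explicit)`, with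
NO printed handle at a non-surjective `p ∥ N`, and it cannot fire (be refuted) in a BSD-consistent world.  Why it might fail: open; nothing in print
controls the parity of `ord_p L(E,1)/Ω` at a prime of small image. [cite: Kato2004Asterisque, §13–14] [cite: Waldspurger1981Fourier, Cor. 2] -/
def EvenShaAn : Prop :=
  ∀ (W : WeierstrassCurve ℚ) [W.IsElliptic] [W.IsGloballyMinimal] (p : ℕ) [Fact p.Prime],
    ClassX11a W p → ¬ Surj W p → 5 ≤ p → (∀ (ℓ : ℕ) [Fact ℓ.Prime], ¬ W.HasSplitMultiplicativeReductionAtPrime ℓ) →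
    (∃ x : W.sha, (p : ℤ) • x = 0 ∧ x ≠ 0) → ∃ q : ℚ, shaAn W = (q : ℂ) ∧ Even (padicValRat p q)

/-- **H♭ — the higher stratum of the exponent core (RESIDUAL; U5 verbatim on R′♭ ∩ {`ord_p #Ш ≥ 3`} = {`#Ш[p^∞] ≥ p⁴`} by Cassels–Tate).**
Here one depth-split Kolyvagin prime pays the analytic exponent once per Cassels–Tate PAIR (`k₁ ≤ a`, §4) and U5 wants it twice (`2Σkᵢ ≤ a`):
the rank-two Kolyvagin induction with drops is the open input.  No known pair lies here (census: `#Ш_an = 25` at all 15 R′ members).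
Why it might fail: open (U5 on a sub-locus). [cite: Kato2004Asterisque, §13–14] [cite: MazurRubin2004, Thm. 5.2.10] -/
def HigherStratumCore : Prop :=
  ∀ (W : WeierstrassCurve ℚ) [W.IsElliptic] [W.IsGloballyMinimal] (p : ℕ) [Fact p.Prime],
    ClassX11a W p → ¬ Surj W p → 5 ≤ p → (∀ (ℓ : ℕ) [Fact ℓ.Prime], ¬ W.HasSplitMultiplicativeReductionAtPrime ℓ) →
    (∃ x : W.sha, (p : ℤ) • x = 0 ∧ x ≠ 0) →
    (∀ t : ℚ, W.entireLFunction 1 / (W.realPeriodRat : ℂ) = (t : ℂ) → padicValRat p t ≠ 0) →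
    2 < padicValNat p W.shaOrder → MissingUpperBoundAt W p

/-- **The nine print-exact named facts of the record's rev-9 glue (one conjunction, BY NAME).**  Stein–Wuthrich Thm. 6.1 (split ∕ nonsplit),
Kato Thm. 12.4, modularity, Kato §17.13 V′ ∕ VI′ ∕ XI′ (contra forms), Mazur Cor. 4.1, Gross–Zagier–Kolyvagin. [cite: SteinWuthrich2013, Thm. 6.1]
[cite: Kato2004Asterisque, Thm. 12.4 and §17.13] [cite: Mazur1978, Cor. 4.1] [cite: Kolyvagin1990, Thm.] -/
def NineFacts : Prop :=
  Literature.NumberTheory.EllipticCurves.SteinWuthrich2013.thm61_splitMultiplicative ∧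
    Literature.NumberTheory.EllipticCurves.SteinWuthrich2013.thm61_nonsplitMultiplicative ∧
    Literature.NumberTheory.EllipticCurves.Kato2004.thm12_4 ∧
    Literature.NumberTheory.EllipticCurves.ModularForms.exists_isNewformOf ∧
    Literature.NumberTheory.EllipticCurves.Kato2004.exists_multDivisibilityInputs_nonsplit_contra ∧
    Literature.NumberTheory.EllipticCurves.Kato2004.exists_multDivisibilityInputs_split_contra ∧
    Literature.NumberTheory.EllipticCurves.Kato2004.exists_multDivisibilityInputs_fine_contra ∧
    Literature.NumberTheory.EllipticCurves.ModularForms.mazur_not_dvd_maninConstant_of_odd ∧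
    rank_eq_analyticRank_of_analyticRank_le_one

/-! ## §2 Stubs (4; `sorry` only here — REV 3: N, R₁′♭, `EvenShaAn` (THE open stub), H♭; T and A are hypothesis-taking witness freedom, §3b) -/

/-- stub N (PRINT INPUTS BY NAME): the nine facts. [cite: SteinWuthrich2013, Thm. 6.1] [cite: Kato2004Asterisque, Thm. 12.4] -/
theorem stub_nineFacts : NineFacts := by
  sorry

/-- stub R₁′♭ (the record's rev-9 Tamagawa ∕ exceptional-zero core, verbatim; shared, not claimed here; = rev 10's C_exc ∧ C_tam ∧ (C_exp off R′♭)
modulo the nine facts, `coreResiduals_of_nineFacts_of_threeCores`). [cite: Kato2004Asterisque, §17.13] -/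
theorem stub_splitMultCore :
    ∀ (W : WeierstrassCurve ℚ) [W.IsElliptic] [W.IsGloballyMinimal] (p : ℕ) [Fact p.Prime],
      ClassX11a W p → ¬ Surj W p → 5 ≤ p →
      (∃ (ℓ : ℕ) (_ : Fact ℓ.Prime), W.HasSplitMultiplicativeReductionAtPrime ℓ) →
      (W.HasSplitMultiplicativeReductionAtPrime p ∨
        ∀ t : ℚ, W.entireLFunction 1 / (W.realPeriodRat : ℂ) = (t : ℂ) → padicValRat p t ≠ 0) →
      MissingUpperBoundAt W p := by
  sorry

/-- stub E = `EvenShaAn` (THE OPEN STUB of the low stratum; BSD-implied, stronger than U5 on {`e = 2`}, no printed handle). [cite: Waldspurger1981Fourier, Cor. 2] -/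
theorem stub_evenShaAn : EvenShaAn := by
  sorry

/-- stub H♭ (residual: U5 on R′♭ ∩ {`ord_p #Ш ≥ 3`}). [cite: Kato2004Asterisque, §13–14] -/
theorem stub_higherStratumCore : HigherStratumCore := by
  sorry

/-! ## §3 Real proofs -/

/-- **Parity step**: `a ≥ 1`, `a − a'` even and `a'` even give `a ≥ 2`. Bookkeeping. [folklore] -/
theorem two_le_of_parity {a a' : ℤ} (h1 : 1 ≤ a) (hT : Even (a - a')) (hA : Even a') : 2 ≤ a := by
  obtain ⟨m, hm⟩ := hT
  obtain ⟨m', hm'⟩ := hA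
  omega

/-- **R′♭ (the record's exponent core) from `EvenShaAn`, H♭ and three of the nine facts (real proof).**  On R′♭: `#Ш_an = q` is `p`-integral
(`shaAnIntegral_of_mazur`) and `ord_p q = ord_p (L(E,1)/Ω) ≠ 0` (`padicValRat_shaAn_eq_padicValRat_LOne_div` + the core's hard-locus hypothesis), so
`a ≥ 1`; `EvenShaAn` makes `a` even, so `a ≥ 2`; case split on `ord_p #Ш ≤ 2`. [cite: Miller2011LMS, Def. 1.1 (arXiv:1010.2431 p. 3)] -/
theorem exponentCore_of_evenShaAn (hGZK : rank_eq_analyticRank_of_analyticRank_le_one)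
    (hnf : Literature.NumberTheory.EllipticCurves.ModularForms.exists_isNewformOf)
    (hMz : Literature.NumberTheory.EllipticCurves.ModularForms.mazur_not_dvd_maninConstant_of_odd)
    (hE : EvenShaAn) (hH : HigherStratumCore) :
    ∀ (W : WeierstrassCurve ℚ) [W.IsElliptic] [W.IsGloballyMinimal] (p : ℕ) [Fact p.Prime],
      ClassX11a W p → ¬ Surj W p → 5 ≤ p → (∀ (ℓ : ℕ) [Fact ℓ.Prime], ¬ W.HasSplitMultiplicativeReductionAtPrime ℓ) →
      (∃ x : W.sha, (p : ℤ) • x = 0 ∧ x ≠ 0) →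
      (∀ t : ℚ, W.entireLFunction 1 / (W.realPeriodRat : ℂ) = (t : ℂ) → padicValRat p t ≠ 0) →
      MissingUpperBoundAt W p := by
  intro W _ _ p _ hX hns hp5 hnsm hSha hhard
  by_cases he : padicValNat p W.shaOrder ≤ 2
  · obtain ⟨q, hq, hq0⟩ :=
      Summit.BirchSwinnertonDyer.BirchSwinnertonDyer.Theorems.GL1Cartan.shaAnIntegral_of_mazur hnf hMz hGZK W p hX hp5 hnsm
    obtain ⟨t, ht, -, -⟩ := hX.exists_LOne_div_realPeriod_eq_of_mazur hnf hMz hp5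
    have hqt : padicValRat p q = padicValRat p t :=
      Summit.BirchSwinnertonDyer.BirchSwinnertonDyer.Theorems.GL1Cartan.padicValRat_shaAn_eq_padicValRat_LOne_div
        hGZK hnf hMz hX hp5 hnsm hq ht
    have h1 : 1 ≤ padicValRat p q := by
      have hne : padicValRat p t ≠ 0 := hhard t ht
      rw [← hqt] at hne
      omega
    obtain ⟨q₂, hq₂, hev⟩ := hE W p hX hns hp5 hnsm hSha
    have hqq : q₂ = q := by
      have h := hq₂.symm.trans hq
      exact_mod_cast h
    rw [hqq] at hev
    have h2 : 2 ≤ padicValRat p q := by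
      obtain ⟨m, hm⟩ := hev
      omega
    refine ⟨q, hq, ?_⟩
    have he' : (padicValNat p W.shaOrder : ℤ) ≤ 2 := by exact_mod_cast he
    exact he'.trans h2
  · exact hH W p hX hns hp5 hnsm hSha hhard (by omega)

/-- **Composition from hypotheses**: the nine facts, R₁′♭, `EvenShaAn` and H♭ give U5 BY NAME, through the landed rev-9 glue
`Theorems.GL1Cartan.upperNonSurjFive_of_nineFacts_of_coreResiduals` (rev 9 ⟺ rev 10 modulo the nine facts, `coreResiduals_of_nineFacts_of_threeCores` /
`threeCores_of_coreResiduals`, landed p677281/p677750). [cite: Miller2011LMS, Def. 1.1] -/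
theorem UpperNonSurjFive_of_hyps (hN : NineFacts)
    (hR₁ : ∀ (W : WeierstrassCurve ℚ) [W.IsElliptic] [W.IsGloballyMinimal] (p : ℕ) [Fact p.Prime],
      ClassX11a W p → ¬ Surj W p → 5 ≤ p →
      (∃ (ℓ : ℕ) (_ : Fact ℓ.Prime), W.HasSplitMultiplicativeReductionAtPrime ℓ) →
      (W.HasSplitMultiplicativeReductionAtPrime p ∨
        ∀ t : ℚ, W.entireLFunction 1 / (W.realPeriodRat : ℂ) = (t : ℂ) → padicValRat p t ≠ 0) →
      MissingUpperBoundAt W p)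
    (hE : EvenShaAn) (hH : HigherStratumCore) :
    Theses.PrintX11a.UpperNonSurjFive := by
  obtain ⟨hJs, hJn, h12, hnf, hns', hsp', hfine', hMz, hGZK⟩ := hN
  exact Summit.BirchSwinnertonDyer.BirchSwinnertonDyer.Theorems.GL1Cartan.upperNonSurjFive_of_nineFacts_of_coreResiduals
    hJs hJn h12 hnf hns' hsp' hfine' hMz hGZK (exponentCore_of_evenShaAn hGZK hnf hMz hE hH) hR₁

/-- **Composition U5 — the crux BY NAME, stub-fed (real proof; REV 3: four stubs, `EvenShaAn` the open one).** [cite: Miller2011LMS, Def. 1.1] -/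
theorem UpperNonSurjFive_of_sqparity : Theses.PrintX11a.UpperNonSurjFive :=
  UpperNonSurjFive_of_hyps stub_nineFacts stub_splitMultCore stub_evenShaAn stub_higherStratumCore

/-! ## §4 The depth-split Kolyvagin engine K (typed, probed, NOT a stub: free-standing target; Euler-system currency for `a ≥ k₁`) -/

/-- **K — exponent bound (NEW mechanism; not consumed by the composition after rev 9).**  On X11a at a non-surjective `p ≥ 5` with no split
multiplicative prime: `#Ш_an ∈ ℚ` is `p`-integral with valuation `a`, and `p^a` KILLS the `p`-primary part of `Ш(E/ℚ)`.  Engine: Kato's `z`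
(`H¹(G_Σ,T_pE) ≅ ℤ_p`, index `M₀`), duality at `p` (`#Ш[p^∞]/S_{Σ_p} ∣ p^{a−M₀}`), ONE Kolyvagin prime of depth `j` (`Frob_q = 1 + p^jX`,
`tr X ≡ 0 (p^j)`, `X̄` invertible: rank-two local conditions `(ℤ/p^j)²`, finite–singular map `−p^jX̄` invertible) bounding the second elementary
divisor of `S_{Σ_p}` by `M₀`, Cassels–Tate for the pair, `−I ∈ im ρ` killing `H¹(ℚ(E[p^m])/ℚ, E[p^m])`; local index at the nonsplit multiplicative `p`
as in Wuthrich 2014 Prop. 21 (whose constant `C` is uncontrolled exactly at such `p`).  Why it might fail: the derivative relation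
`∂κ_q = Q_q(Fr_q⁻¹) loc_q κ₁` is printed for rank-one primes (Rubin 2000 Thm. 4.5.4, Mazur–Rubin 2004 §1.2) and must be re-run at depth-`j` primes.
[cite: Kato2004Asterisque, Thm. 12.5, §13–14] [cite: Rubin2000, Thm. 2.2.3, §4.5] [cite: Wuthrich2014, Prop. 21] [cite: LawsonWuthrich2016, Thm. 1] -/
def ExponentBound : Prop :=
  ∀ (W : WeierstrassCurve ℚ) [W.IsElliptic] [W.IsGloballyMinimal] (p : ℕ) [Fact p.Prime],
    ClassX11a W p → ¬ Surj W p → 5 ≤ p → (∀ (ℓ : ℕ) [Fact ℓ.Prime], ¬ W.HasSplitMultiplicativeReductionAtPrime ℓ) →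
    ∃ q : ℚ, shaAn W = (q : ℂ) ∧ 0 ≤ padicValRat p q ∧
      ∀ x : W.sha, (∃ n : ℕ, ((p : ℤ) ^ n) • x = 0) → ((p : ℤ) ^ (padicValRat p q).toNat) • x = 0

/-- **First order from the exponent bound** (what K gives where `Ш[p] ≠ 0`: `a ≥ 1`, i.e. the UNIT-SECTOR statement of the record in Euler-system
currency — the tree has it in μ-road currency modulo eight facts, `GL1Cartan.noPTorsion_on_unitSector_of_nineFacts`). Bookkeeping. [cite: SilvermanAEC2009, X.4] -/
theorem firstOrder_of_exponentBound {W : WeierstrassCurve ℚ} {p : ℕ} {q : ℚ}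
    (hkill : ∀ x : W.sha, (∃ n : ℕ, ((p : ℤ) ^ n) • x = 0) → ((p : ℤ) ^ (padicValRat p q).toNat) • x = 0)
    (hSha : ∃ x : W.sha, (p : ℤ) • x = 0 ∧ x ≠ 0) : 1 ≤ padicValRat p q := by
  obtain ⟨x, hx, hx0⟩ := hSha
  have hk := hkill x ⟨1, by simpa using hx⟩
  by_contra hlt
  have h0 : (padicValRat p q).toNat = 0 := by omega
  rw [h0, pow_zero, one_smul] at hk
  exact hx0 hk

/-! ### §3b Witness freedom (T and A, hypothesis-taking; kernel-explicit honesty)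
Modulo T (and the three print facts giving `#Ш_an ∈ ℚ`), the anchor A is EQUIVALENT to `EvenShaAn`: `d = 1`, `W' = W` is a square-class twist for
every modulus `M` (`exists_variableChange_quadraticTwist_one`), so an even value of `E` itself witnesses A, and conversely T (at its own modulus `M`)
transports the anchor's even value back to `E`.  `EvenShaAn` is implied by the `p`-part of BSD (lower half ∧ U5 ∧ Cassels–Tate) but NOT by U5 alone
(`a = 3, e = 2` is consistent with U5), and does not imply U5; on the stratum {`e = 2`} it supplies exactly the missing unit (`a ≥ 1 ∧ a` even ⇒
`a ≥ 2`) and is there STRONGER than the target.  The twist language of T ∧ A is WITNESS FREEDOM (any admissible twist in the real square class,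
e.g. a `p`-UNIT twisted value, decides the parity for the whole class), not logical weakness. -/

/-- `d = 1`, `W' = W` is a square-class twist (real proof). [cite: Miller2011LMS, Def. 1.1] -/
theorem squareClassTwist_one (W : WeierstrassCurve ℚ) (p : ℕ) [Fact p.Prime] (M : ℕ) : SquareClassTwist W p M 1 W := by
  refine ⟨one_pos, fun ℓ _ _ => ⟨fun h1 => ?_, ⟨1, ?_⟩⟩, ?_⟩
  · have hℓ := (Fact.out : ℓ.Prime).one_lt
    have h1' : (ℓ : ℤ) ≤ 1 := Int.le_of_dvd one_pos h1
    omega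
  · simp
  · simpa using (exists_variableChange_quadraticTwist_one (W := W))

/-- **A from `EvenShaAn`** (real proof: witness `d = 1`, `W' = W`). [cite: Miller2011LMS, Def. 1.1] -/
theorem parityAnchor_of_evenShaAn (h : EvenShaAn) : ParityAnchor := by
  intro W _ _ p _ M hX hns hp5 hnsm hSha
  obtain ⟨q, hq, hev⟩ := h W p hX hns hp5 hnsm hSha
  exact ⟨1, W, inferInstance, inferInstance, q, squareClassTwist_one W p M, hX.1, hq, hev⟩

/-- **`EvenShaAn` from T ∧ A** (real proof, modulo the three print facts that make `#Ш_an` rational). [cite: Miller2011LMS, Def. 1.1] -/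
theorem evenShaAn_of_transport_anchor
    (hGZK : rank_eq_analyticRank_of_analyticRank_le_one)
    (hnf : Literature.NumberTheory.EllipticCurves.ModularForms.exists_isNewformOf)
    (hMz : Literature.NumberTheory.EllipticCurves.ModularForms.mazur_not_dvd_maninConstant_of_odd)
    (hT : ParityTransport) (hA : ParityAnchor) : EvenShaAn := by
  intro W _ _ p _ hX hns hp5 hnsm hSha
  obtain ⟨q, hq, -⟩ :=
    Summit.BirchSwinnertonDyer.BirchSwinnertonDyer.Theorems.GL1Cartan.shaAnIntegral_of_mazur hnf hMz hGZK W p hX hp5 hnsm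
  obtain ⟨M, -, hTM⟩ := hT W p hX hp5
  obtain ⟨d, W', _, _, q', hsq, hr0, hq', hev'⟩ := hA W p M hX hns hp5 hnsm hSha
  have hev : Even (padicValRat p q - padicValRat p q') := hTM d W' q q' hsq hr0 hq hq'
  refine ⟨q, hq, ?_⟩
  have := hev.add hev'
  simpa using this

/-- **A ⟺ `EvenShaAn` modulo T and the three rationality facts** (real proof). [cite: Miller2011LMS, Def. 1.1] -/
theorem parityAnchor_iff_evenShaAn
    (hGZK : rank_eq_analyticRank_of_analyticRank_le_one)
    (hnf : Literature.NumberTheory.EllipticCurves.ModularForms.exists_isNewformOf)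
    (hMz : Literature.NumberTheory.EllipticCurves.ModularForms.mazur_not_dvd_maninConstant_of_odd)
    (hT : ParityTransport) : ParityAnchor ↔ EvenShaAn :=
  ⟨evenShaAn_of_transport_anchor hGZK hnf hMz hT, parityAnchor_of_evenShaAn⟩

/-- **Composition in witness-freedom form** (hypothesis-taking, CONDITIONAL): `NineFacts`, R₁′♭, T, A, H♭ ⊢ U5 BY NAME (A at T's modulus gives
`EvenShaAn`). [cite: Miller2011LMS, Def. 1.1] -/
theorem UpperNonSurjFive_of_hyps_TA (hN : NineFacts)
    (hR₁ : ∀ (W : WeierstrassCurve ℚ) [W.IsElliptic] [W.IsGloballyMinimal] (p : ℕ) [Fact p.Prime],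
      ClassX11a W p → ¬ Surj W p → 5 ≤ p →
      (∃ (ℓ : ℕ) (_ : Fact ℓ.Prime), W.HasSplitMultiplicativeReductionAtPrime ℓ) →
      (W.HasSplitMultiplicativeReductionAtPrime p ∨
        ∀ t : ℚ, W.entireLFunction 1 / (W.realPeriodRat : ℂ) = (t : ℂ) → padicValRat p t ≠ 0) →
      MissingUpperBoundAt W p)
    (hT : ParityTransport) (hA : ParityAnchor) (hH : HigherStratumCore) : Theses.PrintX11a.UpperNonSurjFive := by
  obtain ⟨hJs, hJn, h12, hnf, hns', hsp', hfine', hMz, hGZK⟩ := hN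
  exact UpperNonSurjFive_of_hyps ⟨hJs, hJn, h12, hnf, hns', hsp', hfine', hMz, hGZK⟩ hR₁
    (evenShaAn_of_transport_anchor hGZK hnf hMz hT hA) hH

/-- **H — the higher stratum of rev 8's residual R′ (no hard-locus hypothesis; used only by the Euler-system-currency composition below).**
U5 verbatim on R′ ∩ {`ord_p #Ш ≥ 3`}. Why it might fail: open (U5 on a sub-locus). [cite: Kato2004Asterisque, §13–14] -/
def HigherStratum : Prop :=
  ∀ (W : WeierstrassCurve ℚ) [W.IsElliptic] [W.IsGloballyMinimal] (p : ℕ) [Fact p.Prime],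
    ClassX11a W p → ¬ Surj W p → 5 ≤ p → (∀ (ℓ : ℕ) [Fact ℓ.Prime], ¬ W.HasSplitMultiplicativeReductionAtPrime ℓ) →
    (∃ x : W.sha, (p : ℤ) • x = 0 ∧ x ≠ 0) → 2 < padicValNat p W.shaOrder → MissingUpperBoundAt W p

/-- **Rev 8's R′ from K, `EvenShaAn`, H (real proof; Euler-system currency: `a ≥ 1` from K instead of from the core's hypothesis).**
[cite: Miller2011LMS, Def. 1.1 (arXiv:1010.2431 p. 3)] -/
theorem pTorsionResidual_of_exponentBound (hK : ExponentBound) (hE : EvenShaAn) (hH : HigherStratum) :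
    ∀ (W : WeierstrassCurve ℚ) [W.IsElliptic] [W.IsGloballyMinimal] (p : ℕ) [Fact p.Prime],
      ClassX11a W p → ¬ Surj W p → 5 ≤ p → (∀ (ℓ : ℕ) [Fact ℓ.Prime], ¬ W.HasSplitMultiplicativeReductionAtPrime ℓ) →
      (∃ x : W.sha, (p : ℤ) • x = 0 ∧ x ≠ 0) → MissingUpperBoundAt W p := by
  intro W _ _ p _ hX hns hp5 hnsm hSha
  by_cases he : padicValNat p W.shaOrder ≤ 2
  · obtain ⟨q, hq, -, hkill⟩ := hK W p hX hns hp5 hnsm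
    have h1 : 1 ≤ padicValRat p q := firstOrder_of_exponentBound hkill hSha
    obtain ⟨q₂, hq₂, hev⟩ := hE W p hX hns hp5 hnsm hSha
    have hqq : q₂ = q := by
      have h := hq₂.symm.trans hq
      exact_mod_cast h
    rw [hqq] at hev
    have h2 : 2 ≤ padicValRat p q := by
      obtain ⟨m, hm⟩ := hev
      omega
    refine ⟨q, hq, ?_⟩
    have he' : (padicValNat p W.shaOrder : ℤ) ≤ 2 := by exact_mod_cast he
    exact he'.trans h2
  · exact hH W p hX hns hp5 hnsm hSha (by omega)

/-- **Composition in Euler-system currency (hypothesis-taking, CONDITIONAL, credits nothing)**: THREE print facts (GZK, modularity, Mazur) + rev 8's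
R₁′ + K + `EvenShaAn` + H give U5 BY NAME through the landed rev-8 glue `upperNonSurjFive_of_facts_of_arithResiduals` — no Stein–Wuthrich / Kato §17.13 /
Mazur–Tate–Teitelbaum constant-term facts; the price is K (new mathematics).  Recorded so that K is a reachable, typed alternative, not a stub.
[cite: Miller2011LMS, Def. 1.1] -/
theorem UpperNonSurjFive_of_hyps_ES
    (hGZK : rank_eq_analyticRank_of_analyticRank_le_one)
    (hnf : Literature.NumberTheory.EllipticCurves.ModularForms.exists_isNewformOf)
    (hMz : Literature.NumberTheory.EllipticCurves.ModularForms.mazur_not_dvd_maninConstant_of_odd)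
    (hR₁ : ∀ (W : WeierstrassCurve ℚ) [W.IsElliptic] [W.IsGloballyMinimal] (p : ℕ) [Fact p.Prime],
      ClassX11a W p → ¬ Surj W p → 5 ≤ p →
      (∃ (ℓ : ℕ) (_ : Fact ℓ.Prime), W.HasSplitMultiplicativeReductionAtPrime ℓ) → MissingUpperBoundAt W p)
    (hK : ExponentBound) (hE : EvenShaAn) (hH : HigherStratum) :
    Theses.PrintX11a.UpperNonSurjFive :=
  Summit.BirchSwinnertonDyer.BirchSwinnertonDyer.Theorems.GL1Cartan.upperNonSurjFive_of_facts_of_arithResiduals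
    hGZK hnf hMz (pTorsionResidual_of_exponentBound hK hE hH) hR₁

end Summit.BirchSwinnertonDyer.BirchSwinnertonDyer.Cruxes.UpperNonSurjFive.SqParity
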